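import Summits.ResolutionOfSingularities.Statement
import Mathlib

/-!
# ResolutionOfSingularities / WeightedInvariant — termination hygiene

Route `ResolutionOfSingularities/WeightedInvariant`, item `stmt-ResolutionOfSingularities-0572`
(DATUM ⇒ EMBEDDED RESOLUTION, informal until the definition `ResolutionDatum` lands). Its proof
shape is "an upper-semicontinuous invariant with values in a well-ordered set takes finitely many
values on a Noetherian space; well-founded induction on `max inv`" (Abramovich–Temkin–Włodarczyk
2024, proof of Thm. 1.1.1; Bierstone–Milman 1997, §1). This file pre-lands the order-theoretic
core, which is characteristic-free and independent of the blow-up calculus: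

* `finite_range_of_isClosed_superlevel` — if every superlevel set `{x | γ ≤ inv x}` is closed
  (upper semicontinuity into a linear order) and the source is a Noetherian topological space and
  the target is well-ordered (`WellFoundedLT`), then `inv` has finite range;
* `exists_max_of_isClosed_superlevel` — hence on a nonempty source `inv` attains a maximum;
* `UpperSemicontinuous` versions.

Proof: an infinite range in a well-order contains a strictly increasing sequence
(`Set.IsPWO.exists_monotone_subseq`), whose superlevel sets are a strictly decreasing sequence of
closed sets, contradicting `WellFoundedLT (Closeds X)`.
-/

namespace Literature.AlgGeom

open TopologicalSpace

/-- Termination core for `stmt-ResolutionOfSingularities-0572`: a function from a Noetherian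
topological space to a well-ordered set all of whose superlevel sets `{x | γ ≤ inv x}` are closed
(i.e. an upper-semicontinuous invariant) takes only finitely many values. [folklore] -/
theorem finite_range_of_isClosed_superlevel {X Γ : Type*} [TopologicalSpace X] [NoetherianSpace X]
    [LinearOrder Γ] [WellFoundedLT Γ] (inv : X → Γ) (h : ∀ γ, IsClosed {x | γ ≤ inv x}) :
    (Set.range inv).Finite := by
  by_contra hinf
  have hi : (Set.range inv).Infinite := hinf
  set f : ℕ → Γ := fun n => (hi.natEmbedding _ n).val with hf
  have hfinj : Function.Injective f := fun m n hmn =>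
    (hi.natEmbedding _).injective (Subtype.val_injective hmn)
  have hpwo : (Set.range inv).IsPWO := (Set.IsWF.of_wellFoundedLT (s := Set.range inv)).isPWO
  obtain ⟨g, hg⟩ := hpwo.exists_monotone_subseq (f := f) (fun n => (hi.natEmbedding _ n).prop)
  have hsm : StrictMono (f ∘ g) := hg.strictMono_of_injective (hfinj.comp g.injective)
  let C : ℕ → Closeds X := fun n => ⟨{x | f (g n) ≤ inv x}, h _⟩
  have hC : ∀ n, C (n + 1) < C n := by
    intro n
    rw [lt_iff_le_and_ne]
    refine ⟨?_, ?_⟩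
    · intro x hx
      exact le_trans (hsm (Nat.lt_succ_self n)).le hx
    · intro heq
      obtain ⟨x, hx⟩ := (hi.natEmbedding _ (g n)).prop
      have hxn : x ∈ (C n : Set X) := by
        show f (g n) ≤ inv x
        simp [hf, hx]
      rw [← heq] at hxn
      have : f (g (n+1)) ≤ inv x := hxn
      have hlt := hsm (Nat.lt_succ_self n)
      simp only [Function.comp] at hlt
      rw [hx] at this
      exact absurd (lt_of_lt_of_le hlt this) (lt_irrefl _)
  exact (RelEmbedding.natGT C hC).not_wellFounded wellFounded_lt

/-- On a nonempty Noetherian space an invariant with closed superlevel sets and well-ordered values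
attains its maximum (the "maximum locus" that a resolution datum blows up). [folklore] -/
theorem exists_max_of_isClosed_superlevel {X Γ : Type*} [TopologicalSpace X] [NoetherianSpace X]
    [Nonempty X] [LinearOrder Γ] [WellFoundedLT Γ] (inv : X → Γ)
    (h : ∀ γ, IsClosed {x | γ ≤ inv x}) : ∃ x : X, ∀ y : X, inv y ≤ inv x := by
  obtain ⟨γ, ⟨x, rfl⟩, hmax⟩ := (finite_range_of_isClosed_superlevel inv h).exists_maximal
    (Set.range_nonempty inv)
  exact ⟨x, fun y => not_lt.mp fun hlt => (hmax ⟨y, rfl⟩ hlt.le).not_gt hlt⟩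

/-- `UpperSemicontinuous` form of `finite_range_of_isClosed_superlevel`: an upper-semicontinuous
map from a Noetherian space to a well-order (any topology on the target is irrelevant; Mathlib's
`UpperSemicontinuous` is purely order-theoretic) has finite range. [folklore] -/
theorem UpperSemicontinuous.finite_range_of_noetherianSpace {X Γ : Type*} [TopologicalSpace X]
    [NoetherianSpace X] [LinearOrder Γ] [WellFoundedLT Γ] {inv : X → Γ}
    (h : UpperSemicontinuous inv) : (Set.range inv).Finite := by
  refine finite_range_of_isClosed_superlevel inv fun γ => ?_
  have hopen : IsOpen (inv ⁻¹' Set.Iio γ) := (upperSemicontinuous_iff_isOpen_preimage.mp h) γ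
  have : {x | γ ≤ inv x} = (inv ⁻¹' Set.Iio γ)ᶜ := by
    ext x; simp
  rw [this]
  exact hopen.isClosed_compl

/-- `UpperSemicontinuous` form of `exists_max_of_isClosed_superlevel`. [folklore] -/
theorem UpperSemicontinuous.exists_max_of_noetherianSpace {X Γ : Type*} [TopologicalSpace X]
    [NoetherianSpace X] [Nonempty X] [LinearOrder Γ] [WellFoundedLT Γ] {inv : X → Γ}
    (h : UpperSemicontinuous inv) : ∃ x : X, ∀ y : X, inv y ≤ inv x := by
  refine exists_max_of_isClosed_superlevel inv fun γ => ?_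
  have hopen : IsOpen (inv ⁻¹' Set.Iio γ) := (upperSemicontinuous_iff_isOpen_preimage.mp h) γ
  have : {x | γ ≤ inv x} = (inv ⁻¹' Set.Iio γ)ᶜ := by
    ext x; simp
  rw [this]
  exact hopen.isClosed_compl

end Literature.AlgGeom
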